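import Mathlib
import Summits.ValiantsHypothesis.ValiantsHypothesis.Theorems.DivisionGapPerMultiplesHardStubHybridSpreadRel
import Summits.ValiantsHypothesis.ValiantsHypothesis.Theorems.DivisionGapPerMultiplesHardStubHybridCaptureRel
import Summits.ValiantsHypothesis.ValiantsHypothesis.Theorems.DivisionGapPerMultiplesHardStubBlockBregman
import Summits.ValiantsHypothesis.ValiantsHypothesis.Theorems.DivisionGapPerMultiplesHardStubFibLeRelaxed
import Summits.ValiantsHypothesis.ValiantsHypothesis.Theorems.DivisionGapPerMultiplesHardStubSpreadRigidity
import Literature.Computability.AlgebraicComplexity.ArithCircuitProofs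
import Literature.Computability.AlgebraicComplexity.PermanentIrreducible

/-!
# `DivisionGap.PerMultiplesHard` (stmt-ValiantsHypothesis-5068), line `uncharged-face-walk`:
stub `stub_hybridDenseHost` — the HYBRID dense-host jaw (composition of the hybrid-probe engine)

Data: a block `A × B` of the board `Fin n × Fin n` (`#A = #B = a ≥ 20`; cells are `(row, column)`,
a permutation `π` maps the column `j` to the row `π j`), a row shift `ζ` preserving `A`, a frozen
matching `π₀` with `π₀(B) = A`, a dump column `bd ∈ B`, a block host `Yb ⊆ A ×ˢ B` with the upper
mixing bound `e_{Yb}(U, T) ≤ β · #U · #T + ε · a²` (`U ⊆ A`, `T ⊆ B`, `0 < β ≤ 1`, `0 ≤ ε ≤ 1`),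
the comparison set `P` of permutations FROZEN to `π₀` off `B` and INSIDE `Yb` on `B`, a real lower
bound `cnt ≤ #P`, and a torus-homogeneous `g ∈ ℝ≥0[x_ij]` with the rows of `A` hit such that every
`π ∈ P` carries a HYBRID PROBE in `supp g` (cells in the rows of `A` are `(i, π⁻¹ i)` or
`(i, π⁻¹ (ζ i))`; cells in the columns of `B ∖ {bd}` lie in rows of `A`).  Conclusion:

  `cnt · 5^{⌊a/10⌋} ≤ L(g) · β^a · a! · 4^{⌊a/10⌋} · exp (30 ε a / β + (log a + 16) / β)`.

This is the proof of `RelDenseHost.stub_relDenseHost` run on the block: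
* (a) every `π ∈ P` maps exactly `B` onto `A`, so the local relative spread engine
  (`HybridSpreadRel.stub_hybridSpreadRel`, window `D = 5`) gives a typed rectangle `(S, T)` with
  `a < 5 k ≤ 2 a`, `k := #(S ∩ A)`, and `#P ≤ L(g) · #Pc`, `Pc` the block-compatible part of `P`
  (all of `P` is probed);
* (b) if `cnt ≤ 0` the claim is trivial; otherwise `P ≠ ∅`, `Pc ≠ ∅`;
* (c) for a compatible `π` the (H)-clause gives `k ≤ 2 #(T ∩ B) ≤ 2 (u + 1)` and the (C)-clause,
  restated on `T₂ := (T ∩ B).erase bd` with `S ∩ A` in place of `S` (`row_of_compatible`,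
  `col_of_compatible`), gives `u := #T₂ ≤ 2 k` (`HybridCaptureRel.card_le_of_row/col`); hence the
  window `a ≤ 20 u`, `5 u ≤ 4 a`, `⌊a/10⌋ ≤ u`, `10 k ≤ 4 a`;
* (d) a maximising fibre `Fib(U) = {π ∈ P : π(T₂) = U}` over `U ⊆ (S ∩ A) ∪ ζ(S ∩ A) ⊆ A`,
  `#U = u`, and `HybridCaptureRel.card_col_le`: `#Pc ≤ C(2k, u) · #Fib(U)`;
* (e) `cnt ≤ #P ≤ L · C(2k, u) · #Fib(U)`, so the fibre is nonempty;
* (f) block Brégman (`BlockBregman.stub_blockBregman`): `#Fib(U) ≤ ∏_{j ∈ B} (d_j !)^{1/d_j}`, all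
  `d_j ≥ 1`; the product and the two degree sums are reindexed to `Fin a` along an enumeration
  `eB : Fin a ≃ B` (`prod_eq_prod_univ`, `sum_filter_eq_sum`, `compl_filter_eq`), double counting
  (`RelDenseHostAux.sum_card_filter_eq_card_filter`) and mixing bound them, and
  `FibLeRelaxed.stub_fibLeRelaxed` at scale `a` gives
  `#Fib(U) ≤ β^a · u! · (a-u)! · exp (30 ε a/β + (log a + 16)/β)`;
* (g) `C(2k, u) · u! · (a-u)! · 5^{⌊a/10⌋} ≤ 4^{⌊a/10⌋} · a!`
  (`SpreadRigidity.descFactorial_mul_five_pow_le`);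
* (h) assembly over `ℝ`.

-- adapted from Theorems/DivisionGapPerMultiplesHardRelDenseHost.lean (p127004: `stub_relDenseHost`),
with the full board replaced by the block `A × B`.
-/

noncomputable section

-- `Summit.ValiantsHypothesis.ValiantsHypothesis.…` is the tree's mandated layout (Sub = Summit).
set_option linter.dupNamespace false

namespace Summit.ValiantsHypothesis.ValiantsHypothesis.Theorems.DivisionGap.PerMultiplesHard.HybridDenseHost

open MvPolynomial Finset Literature.Computability.AlgebraicComplexity
open scoped NNReal BigOperators

/-! ### Reindexing along an enumeration of the column block -/

/-- Reindexing a sum over `T₀ ⊆ B` along an enumeration `eB : Fin a ≃ B`: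
`Σ_{y : eB y ∈ T₀} d (eB y) = Σ_{j ∈ T₀} d j`. [folklore] -/
theorem sum_filter_eq_sum {n a : ℕ} {M : Type*} [AddCommMonoid M] (B T₀ : Finset (Fin n))
    (hT₀ : T₀ ⊆ B) (eB : Fin a ≃ {j // j ∈ B}) (d : Fin n → M) :
    ∑ y ∈ Finset.univ.filter (fun y : Fin a => ((eB y : Fin n)) ∈ T₀), d (eB y) =
      ∑ j ∈ T₀, d j := by
  calc ∑ y ∈ Finset.univ.filter (fun y : Fin a => ((eB y : Fin n)) ∈ T₀), d (eB y)
      = ∑ y : Fin a, (if ((eB y : Fin n)) ∈ T₀ then d (eB y) else 0) := Finset.sum_filter _ _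
    _ = ∑ x : {j // j ∈ B}, (if (x : Fin n) ∈ T₀ then d x else 0) :=
        Equiv.sum_comp eB (fun x : {j // j ∈ B} => if (x : Fin n) ∈ T₀ then d x else 0)
    _ = ∑ j ∈ B, (if j ∈ T₀ then d j else 0) :=
        Finset.sum_coe_sort B (fun j => if j ∈ T₀ then d j else 0)
    _ = ∑ j ∈ B.filter (fun j => j ∈ T₀), d j := (Finset.sum_filter _ _).symm
    _ = ∑ j ∈ T₀, d j := by rw [Finset.filter_mem_eq_inter, Finset.inter_eq_right.mpr hT₀]

/-- The number of indices `y` with `eB y ∈ T₀` is `#T₀` (`T₀ ⊆ B`, `eB : Fin a ≃ B`). [folklore] -/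
theorem card_filter_eq {n a : ℕ} (B T₀ : Finset (Fin n)) (hT₀ : T₀ ⊆ B)
    (eB : Fin a ≃ {j // j ∈ B}) :
    (Finset.univ.filter (fun y : Fin a => ((eB y : Fin n)) ∈ T₀)).card = T₀.card := by
  rw [Finset.card_eq_sum_ones, Finset.card_eq_sum_ones]
  exact sum_filter_eq_sum B T₀ hT₀ eB (fun _ => 1)

/-- The complement of `{y : eB y ∈ T₀}` in `Fin a` is `{y : eB y ∈ B \ T₀}` (`eB : Fin a ≃ B`).
[folklore] -/
theorem compl_filter_eq {n a : ℕ} (B T₀ : Finset (Fin n)) (eB : Fin a ≃ {j // j ∈ B}) :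
    (Finset.univ.filter (fun y : Fin a => ((eB y : Fin n)) ∈ T₀))ᶜ =
      Finset.univ.filter (fun y : Fin a => ((eB y : Fin n)) ∈ B \ T₀) := by
  ext y
  simp only [Finset.mem_compl, Finset.mem_filter, Finset.mem_univ, true_and, Finset.mem_sdiff,
    Finset.coe_mem]

/-- Reindexing a product over `B` along an enumeration `eB : Fin a ≃ B`. [folklore] -/
theorem prod_eq_prod_univ {n a : ℕ} (B : Finset (Fin n)) (eB : Fin a ≃ {j // j ∈ B})
    (F : Fin n → ℝ) : ∏ j ∈ B, F j = ∏ y : Fin a, F (eB y) := by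
  rw [← Finset.prod_coe_sort B F]
  exact (Equiv.prod_comp eB (fun x : {j // j ∈ B} => F x)).symm

/-! ### Block forms of the compatibility clauses -/

/-- **(H)-clause on the block.**  If `π` maps exactly `B` onto `A` and `ζ` preserves `A`, then the
hitting clause `∀ i ∈ S ∩ A, π⁻¹ i ∈ T ∨ π⁻¹ (ζ i) ∈ T` holds with `T ∩ B` in place of `T`
(`π⁻¹ i, π⁻¹ (ζ i) ∈ B` for `i ∈ A`). [folklore] -/
theorem row_of_compatible {n : ℕ} {A B S T : Finset (Fin n)} {ζ : Equiv.Perm (Fin n)}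
    (hζ : ∀ i, ζ i ∈ A ↔ i ∈ A) (π : Equiv.Perm (Fin n)) (hπ : ∀ j, j ∈ B ↔ π j ∈ A)
    (ha : ∀ i ∈ S ∩ A, π.symm i ∈ T ∨ π.symm (ζ i) ∈ T) :
    ∀ i ∈ S ∩ A, π.symm i ∈ T ∩ B ∨ π.symm (ζ i) ∈ T ∩ B := by
  intro i hi
  have hiA : i ∈ A := (Finset.mem_inter.mp hi).2
  have h1 : π.symm i ∈ B := (hπ _).mpr (by rw [Equiv.apply_symm_apply]; exact hiA)
  have h2 : π.symm (ζ i) ∈ B :=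
    (hπ _).mpr (by rw [Equiv.apply_symm_apply]; exact (hζ i).mpr hiA)
  rcases ha i hi with h | h
  · exact Or.inl (Finset.mem_inter.mpr ⟨h, h1⟩)
  · exact Or.inr (Finset.mem_inter.mpr ⟨h, h2⟩)

/-- **(C)-clause on the block.**  If `π` maps exactly `B` onto `A` and `ζ` preserves `A`, then the
column clause `∀ j ∈ T ∩ B, j ≠ bd → π j ∈ S ∨ ζ⁻¹ (π j) ∈ S` gives, on `(T ∩ B).erase bd`, the
one-sided column condition of `HybridCaptureRel` for the row set `S ∩ A`: `π j ∈ A` as `j ∈ B`,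
and `ζ⁻¹ (π j) ∈ A` as `ζ` preserves `A`. [folklore] -/
theorem col_of_compatible {n : ℕ} {A B S T : Finset (Fin n)} {ζ : Equiv.Perm (Fin n)} {bd : Fin n}
    (hζ : ∀ i, ζ i ∈ A ↔ i ∈ A) (π : Equiv.Perm (Fin n)) (hπ : ∀ j, j ∈ B ↔ π j ∈ A)
    (hb : ∀ j ∈ T ∩ B, j ≠ bd → π j ∈ S ∨ ζ.symm (π j) ∈ S) :
    ∀ j ∈ (T ∩ B).erase bd, π j ∈ S ∩ A ∨ ∃ i ∈ S ∩ A, ζ i = π j := by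
  intro j hj
  obtain ⟨hjbd, hjTB⟩ := Finset.mem_erase.mp hj
  have hjA : π j ∈ A := (hπ j).mp (Finset.mem_inter.mp hjTB).2
  rcases hb j hjTB hjbd with h | h
  · exact Or.inl (Finset.mem_inter.mpr ⟨h, hjA⟩)
  · refine Or.inr ⟨ζ.symm (π j), Finset.mem_inter.mpr ⟨h, ?_⟩, ζ.apply_symm_apply _⟩
    exact (hζ _).mp (by rw [Equiv.apply_symm_apply]; exact hjA)

/-! ### The stub -/

/-- **stub_hybridDenseHost — the HYBRID dense-host jaw.**  Data: a block `A × B`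
(`#A = #B = a ≥ 20`), a row shift `ζ` preserving `A`, a frozen matching `π₀` with `π₀(B) = A`, a
dump column `bd ∈ B`, a block host `Yb ⊆ A ×ˢ B` with the upper mixing bound
`e_{Yb}(U, T) ≤ β #U #T + ε a²` (`U ⊆ A`, `T ⊆ B`), the comparison set `P` of permutations frozen
to `π₀` off `B` and inside `Yb` on `B`, a real `cnt ≤ #P`, a torus-homogeneous `g` with the rows
of `A` hit, every `π ∈ P` carrying a hybrid probe in `supp g`.  Conclusion:
`cnt · 5^{⌊a/10⌋} ≤ L(g) · β^a · a! · 4^{⌊a/10⌋} · exp (30 ε a/β + (log a + 16)/β)`.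
Proof: `HybridSpreadRel.stub_hybridSpreadRel` (window `5` on `A`; every `π ∈ P` maps exactly `B`
onto `A`) gives `(S, T)` with `a < 5k ≤ 2a`, `k := #(S ∩ A)`, and `#P ≤ L · #Pc`; if `cnt ≤ 0`
the claim is trivial, else `Pc ≠ ∅` and a compatible `π` gives `k ≤ 2 (u + 1)`, `u ≤ 2 k`
(`row_of_compatible`, `col_of_compatible`, `HybridCaptureRel.card_le_of_row/col`;
`u := #T₂`, `T₂ := (T ∩ B).erase bd`), whence `a ≤ 20 u`, `5 u ≤ 4 a`, `⌊a/10⌋ ≤ u`; a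
maximising fibre and `HybridCaptureRel.card_col_le` give `#Pc ≤ C(2k, u) · #Fib(U)` with
`U ⊆ A`, `#U = u`; the fibre is nonempty, so all block degrees are `≥ 1`
(`BlockBregman.image_apply_subset_blockDegSet`); `BlockBregman.stub_blockBregman`, reindexed to
`Fin a` (`prod_eq_prod_univ`, `sum_filter_eq_sum`, `card_filter_eq`, `compl_filter_eq`), double
counting (`RelDenseHostAux.sum_card_filter_eq_card_filter`) + mixing, and
`FibLeRelaxed.stub_fibLeRelaxed` give `#Fib(U) ≤ β^a u! (a-u)! exp (30 ε a/β + (log a + 16)/β)`;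
finally `C(2k, u) u! (a-u)! 5^{⌊a/10⌋} ≤ 4^{⌊a/10⌋} a!`
(`SpreadRigidity.descFactorial_mul_five_pow_le`). [folklore] -/
theorem stub_hybridDenseHost :
    ∀ (n a : ℕ) (A B : Finset (Fin n)) (Yb : Finset (Fin n × Fin n)) (ζ π₀ : Equiv.Perm (Fin n)) (bd : Fin n),
      20 ≤ a → A.card = a → B.card = a →
      (∀ i, ζ i ∈ A ↔ i ∈ A) → (∀ j, j ∈ B ↔ π₀ j ∈ A) → bd ∈ B → Yb ⊆ A ×ˢ B →
      ∀ (β ε cnt : ℝ), 0 < β → β ≤ 1 → 0 ≤ ε → ε ≤ 1 →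
      (∀ U ⊆ A, ∀ T ⊆ B,
        ((Yb.filter fun e => e.1 ∈ U ∧ e.2 ∈ T).card : ℝ) ≤ β * U.card * T.card + ε * (a : ℝ) ^ 2) →
      cnt ≤ ((((Finset.univ : Finset (Equiv.Perm (Fin n))).filter fun π : Equiv.Perm (Fin n) =>
          (∀ j, j ∉ B → π j = π₀ j) ∧ (∀ j ∈ B, (π j, j) ∈ Yb)).card : ℕ) : ℝ) →
      ∀ (g : MvPolynomial (Fin n × Fin n) ℝ≥0) (R C : Fin n → ℕ),
        (∀ m ∈ g.support, (∀ i, ∑ j, m (i, j) = R i) ∧ (∀ j, ∑ i, m (i, j) = C j)) →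
        (∀ i ∈ A, R i ≠ 0) →
        (∀ π : Equiv.Perm (Fin n), (∀ j, j ∉ B → π j = π₀ j) → (∀ j ∈ B, (π j, j) ∈ Yb) →
          ∃ M ∈ g.support,
            (∀ e ∈ M.support, e.1 ∈ A → (π e.2 = e.1 ∨ π e.2 = ζ e.1)) ∧
            (∀ e ∈ M.support, e.2 ∈ B → e.2 ≠ bd → e.1 ∈ A)) →
        cnt * (5 : ℝ) ^ (a / 10) ≤
          (complexity g : ℝ) * β ^ a * (a.factorial : ℝ) * (4 : ℝ) ^ (a / 10) *
            Real.exp (30 * ε * a / β + (Real.log a + 16) / β) := by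
  intro n a A B Yb ζ π₀ bd h20 hA hB hζ hπ₀ _ hYb β ε cnt hβ hβ1 hε hε1 hmix hcnt g R C hg hR
    hprobe
  -- (b₀) the trivial case `cnt ≤ 0`
  rcases le_or_gt cnt 0 with hcnt0 | hcnt0
  · exact (mul_nonpos_of_nonpos_of_nonneg hcnt0 (by positivity)).trans (by positivity)
  -- (a) the comparison set `P` and the local relative spread engine
  set P : Finset (Equiv.Perm (Fin n)) :=
    (Finset.univ : Finset (Equiv.Perm (Fin n))).filter fun π : Equiv.Perm (Fin n) =>
      (∀ j, j ∉ B → π j = π₀ j) ∧ (∀ j ∈ B, (π j, j) ∈ Yb) with hP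
  have hPmem : ∀ π ∈ P, (∀ j, j ∉ B → π j = π₀ j) ∧ (∀ j ∈ B, (π j, j) ∈ Yb) := fun π hπ =>
    (Finset.mem_filter.mp hπ).2
  -- every `π ∈ P` maps exactly `B` onto `A`
  have hPblk : ∀ π ∈ P, ∀ j, j ∈ B ↔ π j ∈ A := by
    intro π hπ j
    obtain ⟨hoff, hon⟩ := hPmem π hπ
    refine ⟨fun hj => (Finset.mem_product.mp (hYb (hon j hj))).1, fun hjA => ?_⟩
    by_contra hj
    rw [hoff j hj] at hjA
    exact hj ((hπ₀ j).mpr hjA)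
  have h5A : 5 ≤ A.card := by rw [hA]; omega
  obtain ⟨S, T, hlo, hhi, hcap⟩ :=
    HybridSpreadRel.stub_hybridSpreadRel n 5 A B ζ bd (by norm_num) h5A hζ g R C hg hR P hPblk
  rw [hA] at hlo hhi
  -- all of `P` is probed: `#P ≤ L(g) · #Pc`
  have hcapP : P.card ≤ complexity g *
      (P.filter fun π => (∀ i ∈ S ∩ A, π.symm i ∈ T ∨ π.symm (ζ i) ∈ T) ∧
        (∀ j ∈ T ∩ B, j ≠ bd → π j ∈ S ∨ ζ.symm (π j) ∈ S)).card :=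
    (Finset.card_le_card fun π hπ =>
      Finset.mem_filter.mpr ⟨hπ, hprobe π (hPmem π hπ).1 (hPmem π hπ).2⟩).trans hcap
  -- (b) `0 < cnt ≤ #P`: a compatible permutation exists
  have hPpos : 0 < P.card := by
    have h : (0 : ℝ) < (P.card : ℝ) := hcnt0.trans_le hcnt
    exact_mod_cast h
  have hPcne : (P.filter fun π => (∀ i ∈ S ∩ A, π.symm i ∈ T ∨ π.symm (ζ i) ∈ T) ∧
      (∀ j ∈ T ∩ B, j ≠ bd → π j ∈ S ∨ ζ.symm (π j) ∈ S)).Nonempty := by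
    apply Finset.card_pos.mp
    apply Nat.pos_of_ne_zero
    intro h0
    rw [h0, mul_zero] at hcapP
    omega
  obtain ⟨π₁, hπ₁⟩ := hPcne
  obtain ⟨hπ₁P, ha₁, hb₁⟩ := Finset.mem_filter.mp hπ₁
  -- (c) the block forms of the clauses; the window arithmetic
  obtain ⟨T₂, hT₂⟩ : ∃ T₂ : Finset (Fin n), (T ∩ B).erase bd = T₂ := ⟨_, rfl⟩
  have hT₂B : T₂ ⊆ B := by
    rw [← hT₂]; exact (Finset.erase_subset _ _).trans Finset.inter_subset_right
  have hTB : (T ∩ B).card ≤ T₂.card + 1 := by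
    rw [← hT₂]; have := Finset.pred_card_le_card_erase (s := T ∩ B) (a := bd); omega
  have hcolT₂ : ∀ π ∈ P, (∀ j ∈ T ∩ B, j ≠ bd → π j ∈ S ∨ ζ.symm (π j) ∈ S) →
      ∀ j ∈ T₂, π j ∈ S ∩ A ∨ ∃ i ∈ S ∩ A, ζ i = π j := by
    intro π hπ hb
    rw [← hT₂]
    exact col_of_compatible hζ π (hPblk π hπ) hb
  have hk : (S ∩ A).card ≤ 2 * (T ∩ B).card :=
    HybridCaptureRel.card_le_of_row ζ (S ∩ A) (T ∩ B) π₁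
      (row_of_compatible hζ π₁ (hPblk π₁ hπ₁P) ha₁)
  have hu2k : T₂.card ≤ 2 * (S ∩ A).card :=
    HybridCaptureRel.card_le_of_col ζ (S ∩ A) T₂ π₁ (hcolT₂ π₁ hπ₁P hb₁)
  have hua : T₂.card ≤ a := by rw [← hB]; exact Finset.card_le_card hT₂B
  have h20u : a ≤ 20 * T₂.card := by omega
  have h5u : 5 * T₂.card ≤ 4 * a := by omega
  have hfu : a / 10 ≤ T₂.card := by omega
  have hab : 5 * (2 * (S ∩ A).card) ≤ 4 * a := by omega
  -- (d) the maximising fibre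
  obtain ⟨U, hUV, hUmax⟩ := Finset.exists_max_image
    (((S ∩ A) ∪ (S ∩ A).image ⇑ζ).powersetCard T₂.card)
    (fun U => (P.filter fun π : Equiv.Perm (Fin n) => T₂.image ⇑π = U).card)
    ⟨T₂.image ⇑π₁, Finset.mem_powersetCard.mpr
      (HybridCaptureRel.image_sub_of_col ζ (S ∩ A) T₂ π₁ (hcolT₂ π₁ hπ₁P hb₁))⟩
  obtain ⟨hUW, hUu⟩ := Finset.mem_powersetCard.mp hUV
  have hUA : U ⊆ A := by
    intro i hi
    rcases Finset.mem_union.mp (hUW hi) with h | h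
    · exact (Finset.mem_inter.mp h).2
    · obtain ⟨i', hi', rfl⟩ := Finset.mem_image.mp h
      exact (hζ i').mpr (Finset.mem_inter.mp hi').2
  have h3 : (P.filter fun π => (∀ i ∈ S ∩ A, π.symm i ∈ T ∨ π.symm (ζ i) ∈ T) ∧
      (∀ j ∈ T ∩ B, j ≠ bd → π j ∈ S ∨ ζ.symm (π j) ∈ S)).card ≤
      (2 * (S ∩ A).card).choose T₂.card *
        (P.filter fun π : Equiv.Perm (Fin n) => T₂.image ⇑π = U).card :=
    (Finset.card_le_card fun π hπ => by
      obtain ⟨hπP, -, hb⟩ := Finset.mem_filter.mp hπ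
      exact Finset.mem_filter.mpr ⟨hπP, hcolT₂ π hπP hb⟩).trans
      (HybridCaptureRel.card_col_le ζ (S ∩ A) T₂ P _ fun U' hU'W hU'c =>
        hUmax U' (Finset.mem_powersetCard.mpr ⟨hU'W, hU'c⟩))
  -- the fibre in Brégman's form
  have hFU : (P.filter fun π : Equiv.Perm (Fin n) => T₂.image ⇑π = U) =
      ((Finset.univ : Finset (Equiv.Perm (Fin n))).filter fun π : Equiv.Perm (Fin n) =>
        (∀ j, j ∉ B → π j = π₀ j) ∧ (∀ j ∈ B, (π j, j) ∈ Yb) ∧ T₂.image ⇑π = U) := by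
    ext π
    simp only [hP, Finset.mem_filter, Finset.mem_univ, true_and, and_assoc]
  rw [hFU] at h3
  set Fib : Finset (Equiv.Perm (Fin n)) :=
    (Finset.univ : Finset (Equiv.Perm (Fin n))).filter fun π : Equiv.Perm (Fin n) =>
      (∀ j, j ∉ B → π j = π₀ j) ∧ (∀ j ∈ B, (π j, j) ∈ Yb) ∧ T₂.image ⇑π = U with hFib
  -- (e) the counting chain in `ℕ`; the fibre is nonempty
  have hchain : P.card ≤ complexity g * ((2 * (S ∩ A).card).choose T₂.card * Fib.card) :=
    hcapP.trans (Nat.mul_le_mul_left _ h3)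
  have hFne : Fib.Nonempty := by
    apply Finset.card_pos.mp
    apply Nat.pos_of_ne_zero
    intro h0
    rw [h0, mul_zero, mul_zero] at hchain
    omega
  obtain ⟨π, hπ⟩ := hFne
  -- (f) Brégman's block degrees are `≥ 1` on `B`
  set d : Fin n → ℕ := fun j => (if j ∈ T₂ then U.filter fun i => (i, j) ∈ Yb
      else (A \ U).filter fun i => (i, j) ∈ Yb).card with hd
  have hdeg : ∀ j ∈ B, 1 ≤ d j := fun j hj =>
    Finset.card_pos.mpr ⟨π j, BlockBregman.image_apply_subset_blockDegSet n A B Yb T₂ U hYb Fib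
      (fun σ hσ => (Finset.mem_filter.mp hσ).2.2) hj
      (Finset.mem_image_of_mem (fun σ : Equiv.Perm (Fin n) => σ j) hπ)⟩
  -- enumerate the column block, `eB : Fin a ≃ B`, and reindex
  obtain ⟨eB⟩ : Nonempty (Fin a ≃ {j // j ∈ B}) :=
    Fintype.card_eq.mp (by rw [Fintype.card_fin, Fintype.card_coe, hB])
  set r : Fin a → ℕ := fun y => d (eB y) with hr
  set TS : Finset (Fin a) := Finset.univ.filter fun y : Fin a => ((eB y : Fin n)) ∈ T₂ with hTS
  have hTScard : TS.card = T₂.card := card_filter_eq B T₂ hT₂B eB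
  have hr1 : ∀ y, 1 ≤ r y := fun y => hdeg _ (eB y).2
  -- block Brégman, reindexed
  have hX : ((Fib.card : ℕ) : ℝ) ≤ ∏ y, (((r y).factorial : ℕ) : ℝ) ^ ((1 : ℝ) / (r y : ℝ)) := by
    have h := BlockBregman.stub_blockBregman n A B Yb π₀ T₂ U hYb hT₂B hUA
    rw [prod_eq_prod_univ B eB] at h
    exact h
  -- double counting and mixing on `T₂` …
  have hsumT : ((∑ y ∈ TS, r y : ℕ) : ℝ) ≤ β * TS.card * TS.card + ε * (a : ℝ) ^ 2 := by
    have h1 : ∑ y ∈ TS, r y = ∑ j ∈ T₂, d j := sum_filter_eq_sum B T₂ hT₂B eB d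
    have h2 : ∑ j ∈ T₂, d j = (Yb.filter fun e => e.1 ∈ U ∧ e.2 ∈ T₂).card := by
      rw [← RelDenseHostAux.sum_card_filter_eq_card_filter Yb U T₂]
      exact Finset.sum_congr rfl fun j hj => by simp only [hd, if_pos hj]
    rw [h1, h2, hTScard]
    have h := hmix U hUA T₂ hT₂B
    rw [hUu] at h
    exact h
  -- … and on `B \ T₂`
  have hsumC : ((∑ y ∈ TSᶜ, r y : ℕ) : ℝ) ≤ β * TSᶜ.card * TSᶜ.card + ε * (a : ℝ) ^ 2 := by
    have hsd : B \ T₂ ⊆ B := Finset.sdiff_subset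
    have h1 : ∑ y ∈ TSᶜ, r y = ∑ j ∈ B \ T₂, d j := by
      rw [hTS, compl_filter_eq B T₂ eB]
      exact sum_filter_eq_sum B (B \ T₂) hsd eB d
    have h2 : ∑ j ∈ B \ T₂, d j = (Yb.filter fun e => e.1 ∈ A \ U ∧ e.2 ∈ B \ T₂).card := by
      rw [← RelDenseHostAux.sum_card_filter_eq_card_filter Yb (A \ U) (B \ T₂)]
      exact Finset.sum_congr rfl fun j hj => by
        simp only [hd, if_neg (Finset.mem_sdiff.mp hj).2]
    have hc1 : TSᶜ.card = a - T₂.card := by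
      rw [Finset.card_compl, Fintype.card_fin, hTScard]
    have hc2 : (A \ U).card = a - T₂.card := by
      rw [Finset.card_sdiff_of_subset hUA, hA, hUu]
    have hc3 : (B \ T₂).card = a - T₂.card := by
      rw [Finset.card_sdiff_of_subset hT₂B, hB]
    rw [h1, h2, hc1]
    have h := hmix (A \ U) Finset.sdiff_subset (B \ T₂) hsd
    rw [hc2, hc3] at h
    exact h
  -- the analytic fibre bound at scale `a`
  have hfib := FibLeRelaxed.stub_fibLeRelaxed TS β ε _ r hβ hβ1 hε hε1 hX hr1 hsumT hsumC h20
    (by rw [hTScard]; exact h20u) (by rw [hTScard]; exact h5u)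
  rw [hTScard] at hfib
  -- (g) the numerical inequality `C(2k, u) · u! · (a-u)! · 5^{a/10} ≤ 4^{a/10} · a!`
  have hnum : (2 * (S ∩ A).card).choose T₂.card *
      (T₂.card.factorial * (a - T₂.card).factorial) * 5 ^ (a / 10) ≤
      4 ^ (a / 10) * a.factorial := by
    have key := SpreadRigidity.descFactorial_mul_five_pow_le (2 * (S ∩ A).card) a hab T₂.card
      (a / 10) hfu
    calc (2 * (S ∩ A).card).choose T₂.card * (T₂.card.factorial * (a - T₂.card).factorial) *
          5 ^ (a / 10)
        = (2 * (S ∩ A).card).descFactorial T₂.card * 5 ^ (a / 10) *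
            (a - T₂.card).factorial := by
          rw [Nat.descFactorial_eq_factorial_mul_choose]; ring
      _ ≤ 4 ^ (a / 10) * a.descFactorial T₂.card * (a - T₂.card).factorial :=
          Nat.mul_le_mul_right _ key
      _ = 4 ^ (a / 10) * a.factorial := by
          rw [← Nat.factorial_mul_descFactorial hua]; ring
  -- (h) assemble over `ℝ`
  have hchainR : cnt ≤ (complexity g : ℝ) *
      (((2 * (S ∩ A).card).choose T₂.card : ℝ) * ((Fib.card : ℕ) : ℝ)) := by
    have h : ((P.card : ℕ) : ℝ) ≤
        ((complexity g * ((2 * (S ∩ A).card).choose T₂.card * Fib.card) : ℕ) : ℝ) := by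
      exact_mod_cast hchain
    push_cast at h
    exact hcnt.trans h
  have hnumR : ((2 * (S ∩ A).card).choose T₂.card : ℝ) * ((T₂.card.factorial : ℝ) *
      ((a - T₂.card).factorial : ℝ)) * (5 : ℝ) ^ (a / 10) ≤ (4 : ℝ) ^ (a / 10) * a.factorial := by
    exact_mod_cast hnum
  calc cnt * (5 : ℝ) ^ (a / 10)
      ≤ (complexity g : ℝ) * (((2 * (S ∩ A).card).choose T₂.card : ℝ) * ((Fib.card : ℕ) : ℝ)) *
          (5 : ℝ) ^ (a / 10) :=
        mul_le_mul_of_nonneg_right hchainR (by positivity)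
    _ ≤ (complexity g : ℝ) * (((2 * (S ∩ A).card).choose T₂.card : ℝ) *
          (β ^ a * ((T₂.card.factorial : ℝ) * ((a - T₂.card).factorial : ℝ)) *
            Real.exp (30 * ε * a / β + (Real.log a + 16) / β))) * (5 : ℝ) ^ (a / 10) := by
        gcongr
    _ = (complexity g : ℝ) * β ^ a * Real.exp (30 * ε * a / β + (Real.log a + 16) / β) *
          (((2 * (S ∩ A).card).choose T₂.card : ℝ) * ((T₂.card.factorial : ℝ) *
            ((a - T₂.card).factorial : ℝ)) * (5 : ℝ) ^ (a / 10)) := by ring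
    _ ≤ (complexity g : ℝ) * β ^ a * Real.exp (30 * ε * a / β + (Real.log a + 16) / β) *
          ((4 : ℝ) ^ (a / 10) * a.factorial) :=
        mul_le_mul_of_nonneg_left hnumR (by positivity)
    _ = _ := by ring

end Summit.ValiantsHypothesis.ValiantsHypothesis.Theorems.DivisionGap.PerMultiplesHard.HybridDenseHost

end
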